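import Summits.ABC.ABC.Theorems.TwistAmplificationSharpModerateLawDefs

/-!
# Crux `TwistAmplification.SharpModerateLaw` (stmt-ABC-1975), line `syzygy-lattice-half-deep-few-primes`:
few-deep assembly I — level sets and the radical budget

Support file (`--supports stmt-ABC-1975`) of the stub `stub_fewDeepOfLattice : FewDeepOfLattice`
(`LatticeHalf → FieldSum → FewDeepLaw`, file `TwistAmplificationSharpModerateLawFewDeepOfLattice.lean`),
on the objects of `TwistAmplificationSharpModerateLawDefs.lean`; no new definitions. Contents
(namespace `Summit.ABC.ABC.Theorems.SharpModerateLaw.FewDeepSlice`):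
* homogeneity of `F`, `H_F`, `Mplus` in the content `g` (`Mplus F (g•q) = g⁶ · Mplus F q`);
* the cofactor identities `A·F + B·H_F = D·u⁴`, `A'·F + B'·H_F = D·v⁴` (a binary cubic and its Hessian
  have no common zero when `D ≠ 0`), whence `{q : Mplus F q ≤ M}` is finite (`finite_mplus_le`,
  exported as the registered `fewDeepBudget_main`);
* the prime bookkeeping of the content `g`: with `ρ = ∏_{p ≥ 5, p ∣ g} p`, `a = ∏_{p ≥ 5, p ∣ g, p ∣ D} p`
  and the forced divisor `t = ∏_{p ≥ 5, p ∣ g, p ∤ D, p ∣ F(q₀)} p` (entering through defining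
  equations), tower-freeness `g ≤ 216·ρ` (`le_mul_rough`), `rad D · t ∣ rad(D·t)`
  (`radical_mul_forced_dvd`), and the conductor-to-radical budget `rad(D·F(q₀)) ≤ 6·a·t·X/ρ²`
  whenever `N5 F (g•q₀) ≤ X` (`radical_le_budget`: the primes `p ≥ 5` of `g` divide
  `H_F(g•q₀) = g² H_F(q₀)` and are charged `p²` in `N5`, the other primes `p ≥ 5` of `D·F(q₀)` are
  charged `p`).
-/

noncomputable section

namespace Summit.ABC.ABC.Theorems.SharpModerateLaw

namespace FewDeepSlice

open Literature.NumberTheory.CubicFields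
open UniqueFactorizationMonoid (radical radical_dvd_self radical_dvd_radical)
open scoped BigOperators

/-! ## 1. Homogeneity and finiteness of level sets -/

/-- `F(gq) = g³F(q)`. -/
theorem eval_smul' (F : BinaryCubic ℤ) (g u v : ℤ) :
    F.eval (g * u) (g * v) = g ^ 3 * F.eval u v := by
  simp only [BinaryCubic.eval]; ring

/-- `H(gq) = g²H(q)`. -/
theorem hessAt_smul' (F : BinaryCubic ℤ) (g u v : ℤ) :
    hessAt F (g * u) (g * v) = g ^ 2 * hessAt F u v := by
  simp only [hessAt]; ring

/-- `Mplus F (gq) = g⁶ · Mplus F q`. -/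
theorem mplus_smul (F : BinaryCubic ℤ) (g : ℕ) (q : ℤ × ℤ) :
    Mplus F ((g : ℤ) * q.1, (g : ℤ) * q.2) = g ^ 6 * Mplus F q := by
  simp only [Mplus, eval_smul', hessAt_smul', Int.natAbs_mul, Int.natAbs_pow, Int.natAbs_natCast]
  have h1 : F.disc.natAbs * (g ^ 3 * (F.eval q.1 q.2).natAbs) ^ 2 =
      g ^ 6 * (F.disc.natAbs * (F.eval q.1 q.2).natAbs ^ 2) := by ring
  have h2 : 256 * (g ^ 2 * (hessAt F q.1 q.2).natAbs) ^ 3 =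
      g ^ 6 * (256 * (hessAt F q.1 q.2).natAbs ^ 3) := by ring
  rw [h1, h2, Nat.mul_max_mul_left]

/-- Cofactor identity `A·F + B·H = D·u⁴` (`F` and its Hessian have no common zero when `D ≠ 0`). -/
theorem cofactor_fst (F : BinaryCubic ℤ) (u v : ℤ) :
    ((-27 * F.a * F.d ^ 2 + 6 * F.b * F.c * F.d - F.c ^ 3) * u + (3 * F.c ^ 2 * F.d - 9 * F.b * F.d ^ 2) * v)
        * F.eval u v + ((F.c ^ 2 - 4 * F.b * F.d) * u ^ 2 + (- 2 * F.c * F.d) * u * v + (-3 * F.d ^ 2) * v ^ 2)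
        * hessAt F u v = F.disc * u ^ 4 := by
  simp only [hessAt, BinaryCubic.eval, BinaryCubic.disc_eq]; ring

/-- Cofactor identity `A'·F + B'·H = D·v⁴`. -/
theorem cofactor_snd (F : BinaryCubic ℤ) (u v : ℤ) :
    ((3 * F.a * F.b ^ 2 - 9 * F.a ^ 2 * F.c) * u + (-27 * F.a ^ 2 * F.d + 6 * F.a * F.b * F.c - F.b ^ 3) * v)
        * F.eval u v + ((-3 * F.a ^ 2) * u ^ 2 + (-2 * F.a * F.b) * u * v + (F.b ^ 2 - 4 * F.a * F.c) * v ^ 2)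
        * hessAt F u v = F.disc * v ^ 4 := by
  simp only [hessAt, BinaryCubic.eval, BinaryCubic.disc_eq]; ring

/-- From a cofactor identity: `w⁴ ≤ (|α|+|β|+|γ|+|δ|+|η|) · (|u|+|v|)² · M`. -/
theorem pow_four_le_of_cofactor {α β γ δ η f h D u v w M : ℤ}
    (hid : (α * u + β * v) * f + (γ * u ^ 2 + δ * u * v + η * v ^ 2) * h = D * w ^ 4) (hD : D ≠ 0)
    (hf : |f| ≤ M) (hh : |h| ≤ M) :
    w ^ 4 ≤ (|α| + |β| + |γ| + |δ| + |η|) * (|u| + |v|) ^ 2 * M := by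
  have hM : 0 ≤ M := (abs_nonneg f).trans hf
  set m := |u| + |v| with hm
  have hu : |u| ≤ m := by simp [hm]
  have hv : |v| ≤ m := by simp [hm]
  have hm0 : 0 ≤ m := by positivity
  have hmm : m ≤ m ^ 2 := by nlinarith [Int.emod_emod_of_dvd, sq_nonneg (m - 1)]
  have h1 : |α * u + β * v| ≤ (|α| + |β|) * m ^ 2 := by
    calc |α * u + β * v| ≤ |α| * |u| + |β| * |v| := by
          simpa [abs_mul] using abs_add_le (α * u) (β * v)
      _ ≤ |α| * m ^ 2 + |β| * m ^ 2 := by gcongr <;> linarith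
      _ = _ := by ring
  have h2 : |γ * u ^ 2 + δ * u * v + η * v ^ 2| ≤ (|γ| + |δ| + |η|) * m ^ 2 := by
    calc |γ * u ^ 2 + δ * u * v + η * v ^ 2| ≤ |γ| * |u| ^ 2 + |δ| * |u| * |v| + |η| * |v| ^ 2 := by
          refine (abs_add_le _ _).trans (add_le_add ((abs_add_le _ _).trans ?_) ?_)
          · simp [abs_mul, abs_pow]
          · simp [abs_mul, abs_pow]
      _ ≤ |γ| * m ^ 2 + |δ| * m * m + |η| * m ^ 2 := by gcongr
      _ = _ := by ring
  have key : |D| * w ^ 4 ≤ (|α| + |β| + |γ| + |δ| + |η|) * m ^ 2 * M := by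
    calc |D| * w ^ 4 = |(α * u + β * v) * f + (γ * u ^ 2 + δ * u * v + η * v ^ 2) * h| := by
          rw [hid, abs_mul, abs_of_nonneg (by positivity : (0 : ℤ) ≤ w ^ 4)]
      _ ≤ |α * u + β * v| * |f| + |γ * u ^ 2 + δ * u * v + η * v ^ 2| * |h| := by
          have := abs_add_le ((α * u + β * v) * f) ((γ * u ^ 2 + δ * u * v + η * v ^ 2) * h)
          rwa [abs_mul, abs_mul] at this
      _ ≤ (|α| + |β|) * m ^ 2 * M + (|γ| + |δ| + |η|) * m ^ 2 * M := by gcongr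
      _ = _ := by ring
  have hD1 : 1 ≤ |D| := Int.one_le_abs hD
  have hw : 0 ≤ w ^ 4 := by positivity
  nlinarith

/-- `|f| ≤ M` and `|H| ≤ M` on the level set `Mplus ≤ M` (`D ≠ 0`). -/
theorem abs_le_of_mplus_le {F : BinaryCubic ℤ} (hD : F.disc ≠ 0) {q : ℤ × ℤ} {M : ℕ}
    (h : Mplus F q ≤ M) : |F.eval q.1 q.2| ≤ M ∧ |hessAt F q.1 q.2| ≤ M := by
  obtain ⟨h1, h2⟩ := max_le_iff.mp h
  have h1' : |F.disc| * |F.eval q.1 q.2| ^ 2 ≤ M := by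
    have := Int.ofNat_le.mpr h1
    simpa [Int.natCast_natAbs, abs_mul, abs_pow] using this
  have h2' : 256 * |hessAt F q.1 q.2| ^ 3 ≤ M := by
    have := Int.ofNat_le.mpr h2
    simpa [Int.natCast_natAbs, abs_mul, abs_pow] using this
  have hD1 : 1 ≤ |F.disc| := Int.one_le_abs hD
  constructor
  · nlinarith [Int.le_self_sq |F.eval q.1 q.2|, abs_nonneg (F.eval q.1 q.2)]
  · rcases (abs_nonneg (hessAt F q.1 q.2)).eq_or_lt with h0 | h0
    · rw [← h0]; positivity
    · nlinarith [le_self_pow₀ (Int.add_one_le_iff.mpr h0 : (1 : ℤ) ≤ _) (show (3 : ℕ) ≠ 0 by decide)]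

/-- Box bound: `u⁴, v⁴ ≤ K(|u|+|v|)²M` forces `|u|, |v| ≤ 16KM`. -/
theorem abs_le_of_pow_four_le {K M u v : ℤ} (hK : 0 ≤ K) (hM : 0 ≤ M)
    (h1 : u ^ 4 ≤ K * (|u| + |v|) ^ 2 * M) (h2 : v ^ 4 ≤ K * (|u| + |v|) ^ 2 * M) :
    |u| ≤ 16 * K * M ∧ |v| ≤ 16 * K * M := by
  set x := |u| with hx
  set y := |v| with hy
  have hx0 : 0 ≤ x := abs_nonneg u
  have hy0 : 0 ≤ y := abs_nonneg v
  have e1 : u ^ 4 = x ^ 4 := by rw [hx, pow_abs, abs_of_nonneg (by positivity)]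
  have e2 : v ^ 4 = y ^ 4 := by rw [hy, pow_abs, abs_of_nonneg (by positivity)]
  rw [e1] at h1
  rw [e2] at h2
  have a1 : (x + y) ^ 2 ≤ 2 * (x ^ 2 + y ^ 2) := by nlinarith [sq_nonneg (x - y)]
  have a2 : (x ^ 2 + y ^ 2) ^ 2 ≤ 2 * (x ^ 4 + y ^ 4) := by nlinarith [sq_nonneg (x ^ 2 - y ^ 2)]
  have h8 : (x + y) ^ 4 ≤ 16 * K * M * (x + y) ^ 2 := by
    calc (x + y) ^ 4 = ((x + y) ^ 2) ^ 2 := by ring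
      _ ≤ (2 * (x ^ 2 + y ^ 2)) ^ 2 := pow_le_pow_left₀ (by positivity) a1 2
      _ ≤ 8 * (x ^ 4 + y ^ 4) := by nlinarith
      _ ≤ 16 * K * M * (x + y) ^ 2 := by nlinarith
  have hm : x + y ≤ 16 * K * M := by
    rcases (add_nonneg hx0 hy0).eq_or_lt with h0 | h0
    · rw [← h0]; positivity
    · have hsq : (x + y) ^ 2 ≤ 16 * K * M :=
        le_of_mul_le_mul_right (by nlinarith) (by positivity : 0 < (x + y) ^ 2)
      nlinarith
  constructor <;> linarith

/-- **Finiteness of level sets**: for `D ≠ 0`, `{q : Mplus F q ≤ M}` is finite (`F` and `H` have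
no common projective zero: the cofactor identities bound `u⁴, v⁴`). -/
theorem finite_mplus_le {F : BinaryCubic ℤ} (hD : F.disc ≠ 0) (M : ℕ) :
    {q : ℤ × ℤ | Mplus F q ≤ M}.Finite := by
  obtain ⟨K₁, hK₁0, hK₁⟩ : ∃ K : ℤ, 0 ≤ K ∧ ∀ u v N : ℤ, |F.eval u v| ≤ N → |hessAt F u v| ≤ N →
      u ^ 4 ≤ K * (|u| + |v|) ^ 2 * N :=
    ⟨_, by positivity, fun u v N hf hh => pow_four_le_of_cofactor (cofactor_fst F u v) hD hf hh⟩
  obtain ⟨K₂, hK₂0, hK₂⟩ : ∃ K : ℤ, 0 ≤ K ∧ ∀ u v N : ℤ, |F.eval u v| ≤ N → |hessAt F u v| ≤ N →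
      v ^ 4 ≤ K * (|u| + |v|) ^ 2 * N :=
    ⟨_, by positivity, fun u v N hf hh => pow_four_le_of_cofactor (cofactor_snd F u v) hD hf hh⟩
  set R : ℤ := 16 * (K₁ + K₂) * M with hR
  refine (Finset.finite_toSet (Finset.Icc (-R) R ×ˢ Finset.Icc (-R) R)).subset fun q hq => ?_
  obtain ⟨hf, hh⟩ := abs_le_of_mplus_le hD hq
  have hM : (0 : ℤ) ≤ M := by positivity
  have hu : q.1 ^ 4 ≤ (K₁ + K₂) * (|q.1| + |q.2|) ^ 2 * M := (hK₁ _ _ _ hf hh).trans (by gcongr; linarith)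
  have hv : q.2 ^ 4 ≤ (K₁ + K₂) * (|q.1| + |q.2|) ^ 2 * M := (hK₂ _ _ _ hf hh).trans (by gcongr; linarith)
  obtain ⟨h1, h2⟩ := abs_le_of_pow_four_le (add_nonneg hK₁0 hK₂0) hM hu hv
  simp only [Finset.coe_product, Finset.coe_Icc, Set.mem_prod, Set.mem_Icc]
  exact ⟨abs_le.mp h1, abs_le.mp h2⟩

/-! ## 2. Content, primitive part and the prime bookkeeping

For a shell point `q` with content `g = gcd(q)` and primitive part `q₀ = q/g` we use the products of
primes of `g`: `ρ = ∏_{p ≥ 5, p ∣ g} p` (the primes charged `p²` in `N5`), its part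
`a = ∏_{p ≥ 5, p ∣ g, p ∣ D} p` on the primes of `D`, and the forced divisor
`t = ∏_{p ≥ 5, p ∣ g, p ∤ D, p ∣ F(q₀)} p`; they enter the statements through defining equations
`hρ`, `ha`, `ht` (no auxiliary definitions). -/

/-- `q = g • (q/g)` for `g = gcd(q)`. -/
theorem smul_ediv_gcd (q : ℤ × ℤ) :
    ((Int.gcd q.1 q.2 : ℤ) * (q.1 / (Int.gcd q.1 q.2 : ℤ)), (Int.gcd q.1 q.2 : ℤ) * (q.2 / (Int.gcd q.1 q.2 : ℤ)))
      = q :=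
  Prod.ext (Int.mul_ediv_cancel' (Int.gcd_dvd_left _ _)) (Int.mul_ediv_cancel' (Int.gcd_dvd_right _ _))

/-- A product of distinct primes of `g`, each dividing `n`, divides `n`. -/
theorem prod_primeFactors_filter_dvd {g n : ℕ} {P : ℕ → Prop} [DecidablePred P]
    (h : ∀ p ∈ g.primeFactors, P p → p ∣ n) : ∏ p ∈ g.primeFactors with P p, p ∣ n :=
  Finset.prod_primes_dvd n
    (fun _ hp => Nat.prime_iff.mp (Nat.prime_of_mem_primeFactors (Finset.mem_filter.mp hp).1))
    (fun p hp => h p (Finset.mem_filter.mp hp).1 (Finset.mem_filter.mp hp).2)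

/-- Such a product is positive. -/
theorem prod_primeFactors_filter_pos {g : ℕ} {P : ℕ → Prop} [DecidablePred P] :
    0 < ∏ p ∈ g.primeFactors with P p, p :=
  Finset.prod_pos fun _ hp => (Nat.prime_of_mem_primeFactors (Finset.mem_filter.mp hp).1).pos

/-- The primes below `5`. -/
theorem eq_two_or_three {p : ℕ} (hp : p.Prime) (h5 : ¬ 5 ≤ p) : p = 2 ∨ p = 3 := by
  have h2 := hp.two_le
  have h5 := not_le.mp h5
  interval_cases p
  · exact Or.inl rfl
  · exact Or.inr rfl
  · exact absurd hp (by norm_num)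

/-- A prime dividing `n ≠ 0` divides `rad n`. -/
theorem dvd_radical_of_prime {p n : ℕ} (hp : p.Prime) (h : p ∣ n) (hn : n ≠ 0) : p ∣ radical n :=
  Nat.dvd_of_mem_primeFactors (by rw [Nat.primeFactors_radical]; exact Nat.mem_primeFactors.mpr ⟨hp, h, hn⟩)

/-- `rad(D) · t ∣ rad(D · t)` for the forced divisor `t` (squarefree, coprime to `D`). -/
theorem radical_mul_forced_dvd {D g m t : ℕ} (hD : D ≠ 0)
    (ht : t = ∏ p ∈ g.primeFactors with (5 ≤ p ∧ ¬ p ∣ D) ∧ p ∣ m, p) :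
    radical D * t ∣ radical (D * t) := by
  subst ht
  have hf0 : ∏ p ∈ g.primeFactors with (5 ≤ p ∧ ¬ p ∣ D) ∧ p ∣ m, p ≠ 0 :=
    prod_primeFactors_filter_pos.ne'
  refine Nat.Coprime.mul_dvd_of_dvd_of_dvd ?_
    (radical_dvd_radical (dvd_mul_right _ _) (mul_ne_zero hD hf0)) ?_
  · refine Nat.Coprime.prod_right fun p hp => ?_
    obtain ⟨hp, ⟨-, hpD⟩, -⟩ := Finset.mem_filter.mp hp
    exact (((Nat.prime_of_mem_primeFactors hp).coprime_iff_not_dvd).mpr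
      fun h => hpD (h.trans radical_dvd_self)).symm
  · exact prod_primeFactors_filter_dvd fun p hp hP => dvd_radical_of_prime
      (Nat.prime_of_mem_primeFactors hp) (Dvd.dvd.mul_left (Finset.dvd_prod_of_mem (fun p : ℕ => p)
        (Finset.mem_filter.mpr ⟨hp, hP⟩)) _) (mul_ne_zero hD hf0)

/-- Tower-freeness: `g ≤ 216 · ∏_{p ≥ 5, p ∣ g} p` (`2⁴ ∤ g`, `3⁴ ∤ g`, `p² ∤ g` for `p ≥ 5`). -/
theorem le_mul_rough {g : ℕ} (hg : g ≠ 0) (h5 : ∀ p : ℕ, p.Prime → 5 ≤ p → ¬ p ^ 2 ∣ g)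
    (h2 : ¬ 2 ^ 4 ∣ g) (h3 : ¬ 3 ^ 4 ∣ g) : g ≤ 216 * ∏ p ∈ g.primeFactors with 5 ≤ p, p := by
  have hfac : ∏ p ∈ g.primeFactors, p ^ g.factorization p = g := by
    rw [← Nat.support_factorization]; exact Nat.prod_factorization_pow_eq_self hg
  rw [← Finset.prod_filter_mul_prod_filter_not g.primeFactors (fun p => 5 ≤ p)] at hfac
  have hv : ∀ p k : ℕ, ¬ p ^ k ∣ g → g.factorization p < k := fun p k hk => by
    by_contra h
    exact hk ((pow_dvd_pow p (not_lt.mp h)).trans (Nat.ordProj_dvd g p))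
  have hA : ∏ p ∈ g.primeFactors with 5 ≤ p, p ^ g.factorization p ≤
      ∏ p ∈ g.primeFactors with 5 ≤ p, p := by
    refine Finset.prod_le_prod' fun p hp => ?_
    obtain ⟨hp, hp5⟩ := Finset.mem_filter.mp hp
    have hpp := Nat.prime_of_mem_primeFactors hp
    calc p ^ g.factorization p ≤ p ^ 1 :=
          Nat.pow_le_pow_right hpp.pos (Nat.lt_succ_iff.mp (hv p 2 (h5 p hpp hp5)))
      _ = p := pow_one p
  have hB : ∏ p ∈ g.primeFactors with ¬ 5 ≤ p, p ^ g.factorization p ≤ 216 := by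
    have hsub : g.primeFactors.filter (fun p => ¬ 5 ≤ p) ⊆ {2, 3} := by
      intro p hp
      obtain ⟨hp, hp5⟩ := Finset.mem_filter.mp hp
      rcases eq_two_or_three (Nat.prime_of_mem_primeFactors hp) hp5 with rfl | rfl <;> simp
    calc ∏ p ∈ g.primeFactors with ¬ 5 ≤ p, p ^ g.factorization p
        ≤ ∏ p ∈ ({2, 3} : Finset ℕ), p ^ g.factorization p :=
          Finset.prod_le_prod_of_subset_of_one_le' hsub fun p _ _ => Nat.one_le_pow _ _
            (Nat.pos_of_ne_zero fun h0 => by simp_all)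
      _ = 2 ^ g.factorization 2 * 3 ^ g.factorization 3 := by simp
      _ ≤ 2 ^ 3 * 3 ^ 3 := Nat.mul_le_mul (Nat.pow_le_pow_right two_pos (Nat.lt_succ_iff.mp (hv 2 4 h2)))
          (Nat.pow_le_pow_right three_pos (Nat.lt_succ_iff.mp (hv 3 4 h3)))
  calc g = _ := hfac.symm
    _ ≤ (∏ p ∈ g.primeFactors with 5 ≤ p, p) * 216 := Nat.mul_le_mul hA hB
    _ = _ := mul_comm _ _

/-- `N5 F q` is positive. -/
theorem n5_pos (F : BinaryCubic ℤ) (q : ℤ × ℤ) : 0 < N5 F q :=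
  Finset.prod_pos fun p hp => by
    have := (Nat.prime_of_mem_primeFactors (Finset.mem_filter.mp hp).1).pos
    split_ifs <;> positivity

/-- **Conductor budget ⇒ radical budget.** For `q = g • q₀` with `N5 F q ≤ X`:
`rad(D·F(q₀)) ≤ 6 · a · t · X / ρ²` (the primes `p ≥ 5` of `g` are charged `p²` in `N5 F q` since they
divide `H_F(q) = g² H_F(q₀)`; the other primes `p ≥ 5` of `D·F(q₀)` are charged `p`). -/
theorem radical_le_budget {F : BinaryCubic ℤ} (hD : F.disc ≠ 0) {g : ℕ} (hg : g ≠ 0) {q₀ : ℤ × ℤ}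
    (hF₀ : F.eval q₀.1 q₀.2 ≠ 0) {X : ℝ} (hN : (N5 F ((g : ℤ) * q₀.1, (g : ℤ) * q₀.2) : ℝ) ≤ X)
    {a t ρ : ℕ} (ha : a = ∏ p ∈ g.primeFactors with 5 ≤ p ∧ p ∣ F.disc.natAbs, p)
    (ht : t = ∏ p ∈ g.primeFactors with (5 ≤ p ∧ ¬ p ∣ F.disc.natAbs) ∧ p ∣ (F.eval q₀.1 q₀.2).natAbs, p)
    (hρ : ρ = ∏ p ∈ g.primeFactors with 5 ≤ p, p) :
    ((radical (F.disc * F.eval q₀.1 q₀.2).natAbs : ℕ) : ℝ) ≤ 6 * a * t * X / (ρ : ℝ) ^ 2 := by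
  set Dn := F.disc.natAbs with hDn_def
  set m := (F.eval q₀.1 q₀.2).natAbs with hm_def
  set n := (F.disc * F.eval q₀.1 q₀.2).natAbs with hn
  have ha0 : 0 < a := ha ▸ prod_primeFactors_filter_pos
  have ht0 : 0 < t := ht ▸ prod_primeFactors_filter_pos
  have hρ0 : 0 < ρ := hρ ▸ prod_primeFactors_filter_pos
  have hn' : n = Dn * m := Int.natAbs_mul _ _
  have hDn : Dn ≠ 0 := Int.natAbs_ne_zero.mpr hD
  have hm : m ≠ 0 := Int.natAbs_ne_zero.mpr hF₀
  have hn0 : n ≠ 0 := by rw [hn']; exact mul_ne_zero hDn hm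
  set r := ∏ p ∈ n.primeFactors with 5 ≤ p ∧ ¬ p ∣ g, p with hr
  -- (1) `ρ² · r ∣ N5 F q`
  have h1 : ρ ^ 2 * r ∣ N5 F ((g : ℤ) * q₀.1, (g : ℤ) * q₀.2) := by
    have hna : (F.disc * F.eval ((g : ℤ) * q₀.1) ((g : ℤ) * q₀.2)).natAbs = g ^ 3 * n := by
      rw [eval_smul', hn]; simp [Int.natAbs_mul, Int.natAbs_pow]; ring
    simp only [N5]
    rw [hna, hessAt_smul', Nat.primeFactors_mul (pow_ne_zero 3 hg) hn0,
      Nat.primeFactors_pow _ three_ne_zero]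
    have hsub : g.primeFactors.filter (5 ≤ ·) ∪ n.primeFactors.filter (fun p => 5 ≤ p ∧ ¬ p ∣ g) ⊆
        (g.primeFactors ∪ n.primeFactors).filter (5 ≤ ·) := by
      intro p hp
      rcases Finset.mem_union.mp hp with hp | hp
      · obtain ⟨hp, hp5⟩ := Finset.mem_filter.mp hp
        exact Finset.mem_filter.mpr ⟨Finset.mem_union_left _ hp, hp5⟩
      · obtain ⟨hp, hp5, -⟩ := Finset.mem_filter.mp hp
        exact Finset.mem_filter.mpr ⟨Finset.mem_union_right _ hp, hp5⟩
    have hdisj : Disjoint (g.primeFactors.filter (5 ≤ ·))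
        (n.primeFactors.filter (fun p => 5 ≤ p ∧ ¬ p ∣ g)) :=
      Finset.disjoint_left.mpr fun p h1 h2 => (Finset.mem_filter.mp h2).2.2
        (Nat.dvd_of_mem_primeFactors (Finset.mem_filter.mp h1).1)
    refine Dvd.dvd.trans ?_ (Finset.prod_dvd_prod_of_subset _ _ _ hsub)
    rw [Finset.prod_union hdisj]
    refine mul_dvd_mul ?_ (Finset.prod_dvd_prod_of_dvd _ _ fun p _ => ?_)
    · rw [hρ, ← Finset.prod_pow]
      refine Finset.prod_dvd_prod_of_dvd _ _ fun p hp => ?_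
      have hpg : (p : ℤ) ∣ (g : ℤ) := Int.natCast_dvd_natCast.mpr
        (Nat.dvd_of_mem_primeFactors (Finset.mem_filter.mp hp).1)
      rw [if_pos ((dvd_pow hpg two_ne_zero).mul_right _)]
    · split_ifs
      · exact dvd_pow_self p two_ne_zero
      · exact dvd_rfl
  -- (2) `rad n ∣ 6 · (a · t · r)`
  have h2 : radical n ∣ 6 * (a * t * r) := by
    rw [ha, ht, Nat.radical_eq_prod_primeFactors]
    refine Finset.prod_primes_dvd _ (fun p hp => Nat.prime_iff.mp (Nat.prime_of_mem_primeFactors hp))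
      fun p hp => ?_
    have hpp := Nat.prime_of_mem_primeFactors hp
    have hpn := Nat.dvd_of_mem_primeFactors hp
    by_cases hp5 : 5 ≤ p
    · refine Dvd.dvd.mul_left ?_ _
      by_cases hpg : p ∣ g
      · have hpg' : p ∈ g.primeFactors := Nat.mem_primeFactors.mpr ⟨hpp, hpg, hg⟩
        by_cases hpD : p ∣ Dn
        · exact ((Finset.dvd_prod_of_mem _ (Finset.mem_filter.mpr ⟨hpg', hp5, hpD⟩)).mul_right
            _).mul_right _
        · have hpm : p ∣ m := ((Nat.Prime.dvd_mul hpp).mp (hn' ▸ hpn)).resolve_left hpD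
          exact ((Finset.dvd_prod_of_mem _ (Finset.mem_filter.mpr
            ⟨hpg', ⟨hp5, hpD⟩, hpm⟩)).mul_left _).mul_right _
      · exact (Finset.dvd_prod_of_mem _ (Finset.mem_filter.mpr ⟨hp, hp5, hpg⟩)).mul_left _
    · refine Dvd.dvd.mul_right ?_ _
      rcases eq_two_or_three hpp hp5 with rfl | rfl <;> norm_num
  -- (3) assemble over `ℝ`
  have hρr : (0 : ℝ) < ρ := by exact_mod_cast hρ0
  have hX : (ρ : ℝ) ^ 2 * r ≤ X := by
    have := Nat.le_of_dvd (n5_pos F _) h1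
    calc (ρ : ℝ) ^ 2 * r = ((ρ ^ 2 * r : ℕ) : ℝ) := by push_cast; ring
      _ ≤ _ := by exact_mod_cast this
      _ ≤ X := hN
  have h2' : ((radical n : ℕ) : ℝ) ≤ ((6 * (a * t * r) : ℕ) : ℝ) := by
    exact_mod_cast Nat.le_of_dvd (Nat.mul_pos (by norm_num) (Nat.mul_pos (Nat.mul_pos ha0 ht0)
      prod_primeFactors_filter_pos)) h2
  rw [le_div_iff₀ (pow_pos hρr 2)]
  calc ((radical n : ℕ) : ℝ) * (ρ : ℝ) ^ 2
      ≤ ((6 * (a * t * r) : ℕ) : ℝ) * (ρ : ℝ) ^ 2 := by gcongr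
    _ = 6 * a * t * ((ρ : ℝ) ^ 2 * r) := by push_cast; ring
    _ ≤ 6 * a * t * X := by gcongr

end FewDeepSlice

open Literature.NumberTheory.CubicFields FewDeepSlice in
/-- **Export of this support file** (registered name): for `D ≠ 0` every level set
`{q : Mplus F q ≤ M}` is finite (`FewDeepSlice.finite_mplus_le`). -/
theorem fewDeepBudget_main : ∀ (F : BinaryCubic ℤ) (M : ℕ), F.disc ≠ 0 → {q : ℤ × ℤ | Mplus F q ≤ M}.Finite :=
  fun _ M hD => finite_mplus_le hD M

end Summit.ABC.ABC.Theorems.SharpModerateLaw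

end
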